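import Mathlib
import HarnessLib.Audit
import Summits.PneNP.PneNP.Theorems.PstarCoreBound

/-!
# The sumset lemma in `𝔽₂²` (ROUND-24, GAPTWO-PLAN v1 S4a)

FRONTIER range-avoidance ladder, rung F-N3, ROUND 24 (cell `pnp-ideate`, planner memo `CORE-BOUND-NOTES.md` §2; restricted-model proof
complexity — nothing here bears on `P` versus `NP`).

In the free-cube coordinates of the memo a killable chord `e` of a core contributes to the two constraint values one of the READ
VECTORS `0, ρ_e, ρ'_e ∈ 𝔽₂²` (states `∅ / p / p'`), independently of the other chords, so the set of reachable value pairs is the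
Minkowski sum `Σ_e {0, ρ_e, ρ'_e}`, and infeasibility at a point of the cube says that this sum misses the target.  The present file is
the finite classification of when such a sum is NOT all of `𝔽₂²` (memo §2, "SUMSET LEMMA", both directions), phrased with explicit
choice functions (`Reach`) rather than pointwise set sums:

* `reach_all_or` — either every vector of `𝔽₂²` is reachable, or (U1) all read vectors lie in `{0, m}` for one `m`, or (U2) exactly one
  index carries two independent read vectors and all other read vectors vanish;
* `not_reach_of_U1` (then nothing outside `{0, m}` is reachable) and `not_reach_of_U2` (then `ρ + ρ'` of the exceptional index is not
  reachable) — the converse direction.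

`𝔽₂²` is `ZMod 2 × ZMod 2`.
-/

set_option linter.dupNamespace false

open Finset

namespace Summit.PneNP.PneNP.Theorems.PstarReadSumset

/-- The group `𝔽₂²` of value pairs of the two constraints. -/
abbrev V2 : Type := ZMod 2 × ZMod 2

variable {ι : Type*} (E : Finset ι) (ρ ρ' : ι → V2)

/-- `a` is REACHABLE: a choice of one of the read vectors `0, ρ_e, ρ'_e` at every index of `E` sums to `a`. -/
def Reach (a : V2) : Prop := ∃ g : ι → V2, (∀ i ∈ E, g i = 0 ∨ g i = ρ i ∨ g i = ρ' i) ∧ ∑ i ∈ E, g i = a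

/-- Two distinct non-zero vectors of `𝔽₂²` together with `0` and their sum exhaust `𝔽₂²`. -/
theorem span_two {m₁ m₂ : V2} (h₁ : m₁ ≠ 0) (h₂ : m₂ ≠ 0) (h : m₁ ≠ m₂) (a : V2) :
    a = 0 ∨ a = m₁ ∨ a = m₂ ∨ a = m₁ + m₂ := by
  revert a m₁ m₂
  decide

/-- In `𝔽₂²` every element is its own negative: `a + a = 0`. -/
theorem add_self (a : V2) : a + a = 0 := by
  revert a
  decide

/-- Reachability from two indices: choosing `x` at `i`, `y` at `j ≠ i` and `0` elsewhere reaches `x + y`. -/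
theorem reach_pair [DecidableEq ι] {i j : ι} (hi : i ∈ E) (hj : j ∈ E) (hij : i ≠ j) {x y : V2}
    (hx : x = 0 ∨ x = ρ i ∨ x = ρ' i) (hy : y = 0 ∨ y = ρ j ∨ y = ρ' j) : Reach E ρ ρ' (x + y) := by
  refine ⟨fun k => if k = i then x else if k = j then y else 0, fun k _ => ?_, ?_⟩
  · by_cases hki : k = i
    · subst hki; simpa using hx
    · by_cases hkj : k = j
      · subst hkj; simpa [hki] using hy
      · simp [hki, hkj]
  · rw [← add_sum_erase E _ hi]
    simp only [if_true]
    rw [← add_sum_erase (E.erase i) _ (mem_erase.2 ⟨hij.symm, hj⟩)]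
    simp only [if_neg hij.symm, if_true]
    rw [sum_eq_zero fun k hk => ?_, add_zero]
    rw [mem_erase, mem_erase] at hk
    rw [if_neg hk.2.1, if_neg hk.1]

/-- Reachability from one index: choosing `x` at `i` and `0` elsewhere reaches `x`. -/
theorem reach_single [DecidableEq ι] {i : ι} (hi : i ∈ E) {x : V2} (hx : x = 0 ∨ x = ρ i ∨ x = ρ' i) : Reach E ρ ρ' x := by
  refine ⟨fun k => if k = i then x else 0, fun k _ => ?_, ?_⟩
  · by_cases hki : k = i
    · subst hki; simpa using hx
    · simp [hki]
  · rw [← add_sum_erase E _ hi]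
    simp only [if_true]
    rw [sum_eq_zero fun k hk => ?_, add_zero]
    rw [mem_erase] at hk
    rw [if_neg hk.1]

/-- **The sumset lemma, forward direction.**  Either everything is reachable, or (U1) all read vectors lie in `{0, m}` for a single
`m`, or (U2) one index has two independent non-zero read vectors and every other index reads nothing. -/
theorem reach_all_or [DecidableEq ι] :
    (∀ a, Reach E ρ ρ' a) ∨
    (∃ m : V2, ∀ i ∈ E, (ρ i = 0 ∨ ρ i = m) ∧ (ρ' i = 0 ∨ ρ' i = m)) ∨
    (∃ i₀ ∈ E, ρ i₀ ≠ 0 ∧ ρ' i₀ ≠ 0 ∧ ρ i₀ ≠ ρ' i₀ ∧ ∀ i ∈ E, i ≠ i₀ → ρ i = 0 ∧ ρ' i = 0) := by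
  -- the read vectors, tagged by their index
  by_cases hall : ∃ i ∈ E, ∃ j ∈ E, i ≠ j ∧ ∃ x y : V2, (x = ρ i ∨ x = ρ' i) ∧ (y = ρ j ∨ y = ρ' j) ∧ x ≠ 0 ∧ y ≠ 0 ∧ x ≠ y
  · -- two distinct non-zero reads at DIFFERENT indices: everything is reachable
    left
    obtain ⟨i, hi, j, hj, hij, x, y, hx, hy, hx0, hy0, hxy⟩ := hall
    intro a
    rcases span_two hx0 hy0 hxy a with h | h | h | h <;> rw [h]
    · simpa using reach_pair E ρ ρ' hi hj hij (x := 0) (y := 0) (Or.inl rfl) (Or.inl rfl)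
    · simpa using reach_pair E ρ ρ' hi hj hij (x := x) (y := 0) (Or.inr hx) (Or.inl rfl)
    · simpa using reach_pair E ρ ρ' hi hj hij (x := 0) (y := y) (Or.inl rfl) (Or.inr hy)
    · exact reach_pair E ρ ρ' hi hj hij (Or.inr hx) (Or.inr hy)
  · right
    push Not at hall
    -- no cross pair: is there an index with two independent reads?
    by_cases hind : ∃ i₀ ∈ E, ρ i₀ ≠ 0 ∧ ρ' i₀ ≠ 0 ∧ ρ i₀ ≠ ρ' i₀
    · right
      obtain ⟨i₀, hi₀, h1, h2, h3⟩ := hind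
      refine ⟨i₀, hi₀, h1, h2, h3, fun i hi hne => ?_⟩
      -- a non-zero read at `i ≠ i₀` differs from `ρ i₀` or from `ρ' i₀`: a cross pair
      constructor
      · by_contra h
        by_cases hq : ρ i = ρ i₀
        · exact h3 (hq.symm.trans (hall i hi i₀ hi₀ hne (ρ i) (ρ' i₀) (Or.inl rfl) (Or.inr rfl) h h2))
        · exact hq (hall i hi i₀ hi₀ hne (ρ i) (ρ i₀) (Or.inl rfl) (Or.inl rfl) h h1)
      · by_contra h
        by_cases hq : ρ' i = ρ i₀
        · exact h3 (hq.symm.trans (hall i hi i₀ hi₀ hne (ρ' i) (ρ' i₀) (Or.inr rfl) (Or.inr rfl) h h2))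
        · exact hq (hall i hi i₀ hi₀ hne (ρ' i) (ρ i₀) (Or.inr rfl) (Or.inl rfl) h h1)
    · left
      push Not at hind
      -- all non-zero reads coincide
      by_cases hz : ∀ i ∈ E, ρ i = 0 ∧ ρ' i = 0
      · exact ⟨0, fun i hi => ⟨Or.inl (hz i hi).1, Or.inl (hz i hi).2⟩⟩
      · push Not at hz
        obtain ⟨i₁, hi₁, hm⟩ := hz
        -- a non-zero read `m` at `i₁`
        obtain ⟨m, hm0, hmr⟩ : ∃ m : V2, m ≠ 0 ∧ (m = ρ i₁ ∨ m = ρ' i₁) := by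
          by_cases h : ρ i₁ = 0
          · exact ⟨ρ' i₁, hm h, Or.inr rfl⟩
          · exact ⟨ρ i₁, h, Or.inl rfl⟩
        refine ⟨m, fun i hi => ?_⟩
        by_cases hii : i = i₁
        · subst hii
          -- at `i₁` itself the two reads are not independent
          have key : ∀ x : V2, (x = ρ i ∨ x = ρ' i) → x = 0 ∨ x = m := by
            intro x hx
            by_contra hcon
            push Not at hcon
            rcases hmr with rfl | rfl <;> rcases hx with rfl | rfl
            · exact hcon.2 rfl
            · exact hcon.2 (hind i hi hm0 hcon.1).symm
            · exact hcon.2 (hind i hi hcon.1 hm0)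
            · exact hcon.2 rfl
          exact ⟨key _ (Or.inl rfl), key _ (Or.inr rfl)⟩
        · have key : ∀ x : V2, (x = ρ i ∨ x = ρ' i) → x = 0 ∨ x = m := by
            intro x hx
            by_contra hcon
            push Not at hcon
            exact hcon.2 (hall i hi i₁ hi₁ hii x m hx hmr hcon.1 hm0)
          exact ⟨key _ (Or.inl rfl), key _ (Or.inr rfl)⟩

/-- **Converse, case (U1)**: if all read vectors lie in `{0, m}`, only `0` and `m` are reachable. -/
theorem reach_U1 {m : V2} (hm : ∀ i ∈ E, (ρ i = 0 ∨ ρ i = m) ∧ (ρ' i = 0 ∨ ρ' i = m)) {a : V2} (ha : Reach E ρ ρ' a) :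
    a = 0 ∨ a = m := by
  classical
  obtain ⟨g, hg, rfl⟩ := ha
  have hg' : ∀ i ∈ E, g i = 0 ∨ g i = m := by
    intro i hi
    rcases hg i hi with h | h | h
    · exact Or.inl h
    · rw [h]; exact (hm i hi).1
    · rw [h]; exact (hm i hi).2
  -- a sum of elements of `{0, m}` lies in `{0, m}`
  induction E using Finset.induction_on with
  | empty => exact Or.inl (by simp)
  | insert i s hi ih =>
    rw [sum_insert hi]
    have h1 := hg' i (mem_insert_self _ _)
    have h2 := ih (fun j hj => hm j (mem_insert_of_mem hj)) (fun j hj => hg j (mem_insert_of_mem hj))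
      (fun j hj => hg' j (mem_insert_of_mem hj))
    rcases h1 with h1 | h1 <;> rcases h2 with h2 | h2 <;> rw [h1, h2]
    · exact Or.inl (by simp)
    · exact Or.inr (by simp)
    · exact Or.inr (by simp)
    · exact Or.inl (add_self m)

/-- (U1) misses something: no `a ∉ {0, m}` is reachable, and such an `a` exists. -/
theorem not_reach_of_U1 {m : V2} (hm : ∀ i ∈ E, (ρ i = 0 ∨ ρ i = m) ∧ (ρ' i = 0 ∨ ρ' i = m)) :
    ∃ a : V2, ¬ Reach E ρ ρ' a := by
  obtain ⟨a, ha0, ham⟩ : ∃ a : V2, a ≠ 0 ∧ a ≠ m := by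
    have key : ∀ m' : V2, ∃ a : V2, a ≠ 0 ∧ a ≠ m' := by decide
    exact key m
  exact ⟨a, fun h => (reach_U1 E ρ ρ' hm h).elim ha0 ham⟩

/-- **Converse, case (U2)**: with one index of independent reads and nothing else, `ρ + ρ'` of that index is not reachable. -/
theorem not_reach_of_U2 [DecidableEq ι] {i₀ : ι} (hi₀ : i₀ ∈ E) (h1 : ρ i₀ ≠ 0) (h2 : ρ' i₀ ≠ 0) (h3 : ρ i₀ ≠ ρ' i₀)
    (hz : ∀ i ∈ E, i ≠ i₀ → ρ i = 0 ∧ ρ' i = 0) : ¬ Reach E ρ ρ' (ρ i₀ + ρ' i₀) := by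
  rintro ⟨g, hg, hsum⟩
  have hzero : ∀ i ∈ E.erase i₀, g i = 0 := by
    intro i hi
    rw [mem_erase] at hi
    rcases hg i hi.2 with h | h | h
    · exact h
    · rw [h]; exact (hz i hi.2 hi.1).1
    · rw [h]; exact (hz i hi.2 hi.1).2
  rw [← add_sum_erase E _ hi₀, sum_eq_zero hzero, add_zero] at hsum
  rcases hg i₀ hi₀ with h | h | h <;> rw [h] at hsum
  · have : ρ i₀ = ρ' i₀ := by
      have := congrArg (· + ρ' i₀) hsum
      simp only [zero_add, add_assoc, add_self, add_zero] at this
      exact this.symm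
    exact h3 this
  · have : ρ' i₀ = 0 := by
      have := congrArg (ρ i₀ + ·) hsum
      simpa [← add_assoc, add_self] using this.symm
    exact h2 this
  · have : ρ i₀ = 0 := by
      have := congrArg (· + ρ' i₀) hsum
      simpa [add_assoc, add_self] using this.symm
    exact h1 this

end Summit.PneNP.PneNP.Theorems.PstarReadSumset
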